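import Literature.Probability.RandomPlanarGeometry.SAWCountZdSymbolThirdCancellationUnconditional
import HarnessLib

/-!
# THE MONIC FACE OF `P₅` IS STRUCTURAL: `deg S_j = j` and `lc S_j = (−1)^j/(2^j·j!)` for every `2 ≤ j ≤ 5`; the leading asymptotics `[d^{n−5}] c_n = −2^n n^5/3840 + O(2^n n^4)`

Topic `Literature/Probability/RandomPlanarGeometry` (the «SYMBOL POLYNOMIALITY» programme for `c_n(ℤ^d)`; a corollary of `SAWCountZdSymbolThirdCancellationUnconditional.lean`
(a-p1 g27: the third cancellation `natDegree_symbolCorrPoly_le_sub_six'`, `deg B_j ≤ 2j − 6` for `j ≥ 5`), `SAWCountZdSymbolSecondCancellationUnconditional.lean` (a-p1 g26: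
`natDegree_coeffPoly_of_le_four`), `SAWCountZdSymbolFirstCancellation.lean` (a-p1 g26: `coeffPoly = symbolMainPoly − symbolCorrPoly`, `natDegree_symbolMainPoly`,
`leadingCoeff_symbolMainPoly`, `countPoly_coeff_eq_pow_mul_eval_coeffPoly`)).

PRINTED CONTEXT (locators only; nothing below is in print). Madras–Slade (1993) §1.1 eq. (1.1.8) p. 5, Definition 1.2.4, §1.2 p. 10; Clisby–Liang–Slade (2007) §3.3 eqs. (29)/(31).

THE THEOREM. `[X^{n−j}] P_n = 2^n S_j(n)` with `S_j = A_j − B_j`, `deg A_j = j`, `lc A_j = (−1)^j/(2^j j!)`. The three cancellations give `deg B_j ≤ 2j − 6` for `j ≥ 5`, and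
`2j − 6 < j` exactly for `j ≤ 5`: so ★★★ `natDegree_coeffPoly_of_le_five` — for EVERY `2 ≤ j ≤ 5` the coefficient polynomial `S_j` has degree EXACTLY `j` and leading coefficient
`(−1)^j/(2^j·j!)`; in particular (★★ `countPoly_coeff_sub_five_eq`) the fifth `1/d`-symbol `[d^{n−5}] c_n(ℤ^d) = 2^n S_5(n)` with `deg S_5 = 5`, `lc S_5 = −1/3840` for all `n ≥ 9` —
the monic face `−n⁵` of the lane's (L1″) `P₅ = −(n⁵ − 30n⁴ + 395n³ − 3090n² + 14194n − 29760)` (FINDING-ZD-FOURTH-SYMBOL §8 STRUCTURE CONJECTURE «`deg P_j = j`, leading term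
`(−1)^j n^j 2^{n−j}/j!`», now structural for `j ≤ 5`; `j = 6` needs the fourth cancellation).

THIS FILE (lane «pcv-sawmu», a-p1 g27; all PROVED, standard axioms): ★★★ `natDegree_coeffPoly_of_le_five`, ★★ `countPoly_coeff_sub_five_eq`.
[cite: MadrasSlade1993, §1.1 eq. (1.1.8) p. 5; Definition 1.2.4; §1.2 (p. 10)] [cite: ClisbyLiangSlade2007, §3.3 eqs. (29)/(31)]

Provenance: lane «pcv-sawmu», a-p1 g27 (2026-08-28).
-/

noncomputable section

open Finset
open scoped BigOperators
open Literature.Probability.LatticeModels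
open Literature.Probability.RandomPlanarGeometry.SAW
open Literature.Probability.Percolation

namespace Literature.Probability.RandomPlanarGeometry.SAW.Zd

namespace WordTypes

/-- ★★★ THE MONIC FACE FOR `j ≤ 5`: for `2 ≤ j ≤ 5` the coefficient polynomial `S_j` has degree EXACTLY `j` and leading coefficient `(−1)^j/(2^j·j!)` — the bad-word correction
is subleading (`deg B_5 ≤ 4 < 5` by the third cancellation; `j ≤ 4` by the first two). [cite: MadrasSlade1993, §1.1 eq. (1.1.8) p. 5; Definition 1.2.4]
[cite: ClisbyLiangSlade2007, §3.3 eqs. (29)/(31); lane theorem] -/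
theorem natDegree_coeffPoly_of_le_five (j : ℕ) (hj : 2 ≤ j) (hj5 : j ≤ 5) :
    (coeffPoly j).natDegree = j ∧ (coeffPoly j).leadingCoeff = (-1 : ℚ) ^ j / (2 ^ j * (j.factorial : ℚ)) := by
  rcases Nat.lt_or_ge j 5 with h | h
  · exact natDegree_coeffPoly_of_le_four j hj (by omega)
  · have hj5' : j = 5 := by omega
    subst hj5'
    have hB : (symbolCorrPoly 5).natDegree < 5 := lt_of_le_of_lt (natDegree_symbolCorrPoly_le_sub_six' 5 le_rfl) (by norm_num)
    have hB' : (symbolCorrPoly 5).degree < (symbolMainPoly 5).degree := by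
      rw [Polynomial.degree_eq_natDegree (p := symbolMainPoly 5) (by
        intro h0; have := natDegree_symbolMainPoly 5; rw [h0, Polynomial.natDegree_zero] at this; omega), natDegree_symbolMainPoly]
      exact lt_of_le_of_lt (Polynomial.degree_le_natDegree) (by exact_mod_cast hB)
    refine ⟨?_, ?_⟩
    · rw [coeffPoly, Polynomial.natDegree_sub_eq_left_of_natDegree_lt (by rw [natDegree_symbolMainPoly]; exact hB), natDegree_symbolMainPoly]
    · rw [coeffPoly, Polynomial.leadingCoeff_sub_of_degree_lt hB', leadingCoeff_symbolMainPoly]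

/-- ★★ THE FIFTH SYMBOL'S MONIC FACE: for every `n ≥ 9`, `[d^{n−5}] c_n(ℤ^d) = 2^n·S_5(n)` where `S_5 ∈ ℚ[X]` has degree exactly `5` and leading coefficient
`−1/3840 = −1/(2⁵·5!)`
— the structural shadow of the lane's certified `P₅` law (L1″). [cite: MadrasSlade1993, §1.1 eq. (1.1.8) p. 5; §1.2 p. 10]
[cite: ClisbyLiangSlade2007, §3.3 eqs. (29)/(31); lane theorem] -/
theorem countPoly_coeff_sub_five_eq :
    (coeffPoly 5).natDegree = 5 ∧ (coeffPoly 5).leadingCoeff = -(1 / 3840 : ℚ) ∧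
      ∀ n : ℕ, 9 ≤ n → (countPoly n).coeff (n - 5) = 2 ^ n * (coeffPoly 5).eval (n : ℚ) := by
  obtain ⟨h1, h2⟩ := natDegree_coeffPoly_of_le_five 5 (by norm_num) le_rfl
  refine ⟨h1, by rw [h2]; norm_num [Nat.factorial], fun n hn => countPoly_coeff_eq_pow_mul_eval_coeffPoly 5 (by norm_num) n (by omega)⟩

end WordTypes

end Literature.Probability.RandomPlanarGeometry.SAW.Zd
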